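import Literature.MathematicalPhysics.KineticTheory.HardSphereTwoTimePressure
import Literature.MathematicalPhysics.KineticTheory.HardSphereEulerProofs
import Literature.MathematicalPhysics.KineticTheory.HardSphereBBGKYLiouvilleFlow
import Literature.Analysis.FluidPDE.HardSphereTorusMeasure
import Summits.AtomisticToContinuum.HydrodynamicLimit.Theorems.LambertianContactSwapLambertianEulerTailsZero
import Summits.AtomisticToContinuum.HydrodynamicLimit.Theorems.OneFlightGossipEngineSuperExponentialEnergyTailsDefsB
import HarnessLib

/-!
# Finiteness and continuity in time of the true-law velocity moments (stub R of line `Sketch`,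
# crux `SuperExponentialEnergyTails`, stmt-AtomisticToContinuum-17701), stage 3/4

Stub worker file for the registered stub `stub_momentRegularity : MomentRegularity` of the line lead's
skeleton `Cruxes/SuperExponentialEnergyTails/Lines/Sketch.lean` (lead prover-line-stmt-AtomisticToContinuum-17701-0).
This stage proves the fields `finite` and `continuousOn` of `SuperExponentialEnergyTailsLine.MomentRegularityFor σ a₀ u₀ θ₀`
for continuous data `a₀, θ₀ > 0`, `u₀` and `0 < σ ≤ 1/2`, packaged as the registered helper `momentContinuity`.

* ENERGY ENVELOPE `avg_powSum_flow_le`: on the good set `(N+1)⁻¹ ∑ᵢ ‖vᵢ(s)‖ᵖ ≤ (1 + ∑ⱼ ‖vⱼ(0)‖²)ᵖ` for every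
  time `s` (each speed is bounded by the conserved kinetic energy, `HardSphereFlow.configEnergy_flow`), and
  its integrability `lintegral_envelope_lt_top` under the local Gibbs law (Gaussian velocity marginals: the
  per-particle exponential moment `LambertianContactSwapLambertianEulerTailsZero.tailsZero_lintegral_exp_localGibbsLaw_le`
  and `xᵖ/p! ≤ eˣ`); whence `finite`.
* CONTINUITY: for `λ_N`-a.e. `z` the velocities `s ↦ vᵢ(Φ_s z)` are constant on a neighbourhood of any fixed
  time `s₀` — the orbit is a hard-sphere trajectory with locally finitely many collision times
  (`IsHardSphereTrajectory.locFinite`), free flight keeps the velocities (`IsHardSphereTrajectory.free`,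
  `freeFlight_apply`), and `s₀` is a collision time only on the `λ_N`-null set
  `Φ_{s₀}⁻¹(⋃_{i≠j} contactSet)` (`volume_contactSet`, Liouville invariance
  `HardSphereFlow.liouville_preimage_null`, `λ_N ≪ Liouville`); dominated convergence
  (`tendsto_lintegral_filter_of_dominated_convergence`, the envelope as the bound) then gives continuity of
  `s ↦ M_p(s)` at every `s₀`, and `ENNReal.toReal` is continuous at the finite value.
-/

noncomputable section

open MeasureTheory Set Filter Topology
open scoped ENNReal BigOperators

namespace Summit.AtomisticToContinuum.HydrodynamicLimit.Theorems.SuperExponentialEnergyTailsMomentRegularity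

open Literature.MathematicalPhysics.KineticTheory Literature.Analysis.FluidPDE
open Summit.AtomisticToContinuum.HydrodynamicLimit.Theorems.SuperExponentialEnergyTailsLine (velMoment)

/-! ## The energy envelope -/

section Envelope

variable {N : ℕ} {ε : ℝ}

/-- Along a good orbit each squared speed is bounded by twice the conserved kinetic energy:
`‖vᵢ(s)‖² ≤ ∑ⱼ ‖vⱼ(0)‖²` (`HardSphereFlow.configEnergy_flow`). [folklore] -/
theorem sq_norm_vel_flow_le (Φ : HardSphereFlow (Torus.geometry (Fin 3)) ε (N + 1))
    {z : Config (N + 1) (Fin 3) T3} (hz : z ∈ Φ.good) (s : ℝ) (i : Fin (N + 1)) :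
    ‖(Φ.flow s z i).2‖ ^ 2 ≤ ∑ j, ‖(z j).2‖ ^ 2 := by
  have hE := Φ.configEnergy_flow hz s
  simp only [configEnergy] at hE
  have hsum : ∑ j, ‖(Φ.flow s z j).2‖ ^ 2 = ∑ j, ‖(z j).2‖ ^ 2 := by
    have h2 := congrArg (fun x : ℝ => 2 * x) hE
    simpa only [← mul_assoc, mul_inv_cancel₀ (two_ne_zero (α := ℝ)), one_mul] using h2
  rw [← hsum]
  exact Finset.single_le_sum (f := fun j => ‖(Φ.flow s z j).2‖ ^ 2) (fun j _ => by positivity)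
    (Finset.mem_univ i)

/-- `xᵖ ≤ (1 + x²)ᵖ` for `x ≥ 0` (since `x ≤ 1 + x²`). [folklore] -/
theorem pow_le_one_add_sq_pow {x : ℝ} (hx : 0 ≤ x) (p : ℕ) : x ^ p ≤ (1 + x ^ 2) ^ p :=
  pow_le_pow_left₀ hx (by nlinarith [sq_nonneg (x - 1)]) p

/-- **The energy envelope.**  On the good set, for every time `s` and every power `p`,
`(N+1)⁻¹ ∑ᵢ ‖vᵢ(s)‖ᵖ ≤ (1 + ∑ⱼ ‖vⱼ(0)‖²)ᵖ` — a dominating function independent of `s`. [folklore] -/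
theorem avg_powSum_flow_le (Φ : HardSphereFlow (Torus.geometry (Fin 3)) ε (N + 1))
    {z : Config (N + 1) (Fin 3) T3} (hz : z ∈ Φ.good) (p : ℕ) (s : ℝ) :
    ((N : ℝ) + 1)⁻¹ * ∑ i : Fin (N + 1), ‖(Φ.flow s z i).2‖ ^ p ≤ (1 + ∑ j, ‖(z j).2‖ ^ 2) ^ p := by
  have hle : ∀ i, ‖(Φ.flow s z i).2‖ ^ p ≤ (1 + ∑ j, ‖(z j).2‖ ^ 2) ^ p := fun i =>
    (pow_le_one_add_sq_pow (norm_nonneg _) p).trans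
      (pow_le_pow_left₀ (by positivity) (by linarith [sq_norm_vel_flow_le Φ hz s i]) p)
  have hN : (0 : ℝ) < (N : ℝ) + 1 := by positivity
  calc ((N : ℝ) + 1)⁻¹ * ∑ i : Fin (N + 1), ‖(Φ.flow s z i).2‖ ^ p
      ≤ ((N : ℝ) + 1)⁻¹ * ∑ _i : Fin (N + 1), (1 + ∑ j, ‖(z j).2‖ ^ 2) ^ p :=
        mul_le_mul_of_nonneg_left (Finset.sum_le_sum fun i _ => hle i) (inv_nonneg.2 hN.le)
    _ = (1 + ∑ j, ‖(z j).2‖ ^ 2) ^ p := by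
        rw [Finset.sum_const, Finset.card_univ, Fintype.card_fin, nsmul_eq_mul, Nat.cast_add_one,
          ← mul_assoc, inv_mul_cancel₀ hN.ne', one_mul]

/-- `(1 + y)ᵖ ≤ p! a^{−p} eᵃ e^{a y}` for `y ≥ 0`, `a > 0` (from `xᵖ/p! ≤ eˣ` at `x = a (1 + y)`). [folklore] -/
theorem one_add_pow_le_exp {a y : ℝ} (ha : 0 < a) (hy : 0 ≤ y) (p : ℕ) :
    (1 + y) ^ p ≤ (p.factorial : ℝ) * (a ^ p)⁻¹ * Real.exp a * Real.exp (a * y) := by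
  have hx : 0 ≤ a * (1 + y) := by positivity
  have h := Real.pow_div_factorial_le_exp (a * (1 + y)) hx p
  rw [div_le_iff₀ (by positivity : (0 : ℝ) < p.factorial), mul_pow] at h
  have hap : 0 < a ^ p := pow_pos ha p
  rw [mul_assoc, ← Real.exp_add, ← mul_one_add a y]
  calc (1 + y) ^ p = (a ^ p)⁻¹ * (a ^ p * (1 + y) ^ p) := by
        rw [← mul_assoc, inv_mul_cancel₀ hap.ne', one_mul]
    _ ≤ (a ^ p)⁻¹ * (Real.exp (a * (1 + y)) * p.factorial) :=
        mul_le_mul_of_nonneg_left h (inv_nonneg.2 hap.le)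
    _ = (p.factorial : ℝ) * (a ^ p)⁻¹ * Real.exp (a * (1 + y)) := by ring

/-- Crude power of a sum: `(∑ⱼ gⱼ)ᵖ ≤ n ^ p ∑ⱼ gⱼᵖ` for `gⱼ ≥ 0` on `Fin (N+1)` (`n = N + 1`; Jensen
`pow_sum_le_card_mul_sum_pow` for `p ≥ 1`, trivial for `p = 0`). [folklore] -/
theorem pow_sum_le_pow_card_mul_sum_pow (g : Fin (N + 1) → ℝ) (hg : ∀ j, 0 ≤ g j) (p : ℕ) :
    (∑ j, g j) ^ p ≤ ((N : ℝ) + 1) ^ p * ∑ j, g j ^ p := by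
  rcases p with _ | q
  · simp
  · have h := pow_sum_le_card_mul_sum_pow (s := Finset.univ) (f := g) (fun j _ => hg j) q
    rw [Finset.card_univ, Fintype.card_fin, Nat.cast_add_one] at h
    refine h.trans (mul_le_mul_of_nonneg_right ?_ (Finset.sum_nonneg fun j _ => pow_nonneg (hg j) _))
    exact pow_le_pow_right₀ (by linarith [(Nat.cast_nonneg N : (0 : ℝ) ≤ N)]) (Nat.le_succ q)

/-- Measurability of the normalised power integrand along the flow (private copy: the sibling stage files of stub R are
import-unreachable at submission time). [folklore] -/
private theorem measurable_ofReal_avg_powSum (Φ : HardSphereFlow (Torus.geometry (Fin 3)) ε (N + 1)) (q : ℕ)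
    (s : ℝ) : Measurable fun z : Config (N + 1) (Fin 3) T3 =>
      ENNReal.ofReal (((N : ℝ) + 1)⁻¹ * ∑ i : Fin (N + 1), ‖(Φ.flow s z i).2‖ ^ q) := by
  refine ENNReal.measurable_ofReal.comp (Measurable.const_mul ?_ _)
  refine Finset.measurable_sum _ fun i _ => ?_
  exact (((measurable_pi_apply i).comp (Φ.measurable_flow s)).snd.norm).pow_const q

end Envelope

/-! ## Integrability of the envelope and finiteness -/

section Gibbs

variable {a₀ θ₀ : T3 → ℝ} {u₀ : T3 → V3}

/-- **Gaussian moments of the local Gibbs law: the envelope is integrable.**  For continuous data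
`a₀, θ₀ > 0`, `u₀`, `σ ≤ 1/2`, every `N`, `Φ` and power `p`: `∫ (1 + ∑ⱼ ‖vⱼ‖²)ᵖ dλ_N < ∞`
(`(∑ⱼ gⱼ)ᵖ ≤ (N+1)ᵖ ∑ⱼ gⱼᵖ` with `gⱼ = 1 + ‖vⱼ‖²`, `gⱼᵖ ≤ p! a⁻ᵖ eᵃ e^{a‖vⱼ‖²}`, and the per-particle
exponential moment `tailsZero_lintegral_exp_localGibbsLaw_le`). [folklore] -/
theorem lintegral_envelope_lt_top (ha : Continuous a₀) (hθ : Continuous θ₀) (hu : Continuous u₀)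
    (ha0 : ∀ x, 0 < a₀ x) (hθ0 : ∀ x, 0 < θ₀ x) {σ : ℝ} (hσ2 : σ ≤ 1 / 2) (N : ℕ)
    (Φ : HardSphereFlow (Torus.geometry (Fin 3)) (hsDiameter σ N) (N + 1)) (p : ℕ) :
    ∫⁻ z, ENNReal.ofReal ((1 + ∑ j, ‖(z j).2‖ ^ 2) ^ p) ∂(localGibbsLaw σ a₀ u₀ θ₀ N Φ) < ∞ := by
  obtain ⟨a, ha_pos, K, hK⟩ :=
    LambertianContactSwapLambertianEulerTailsZero.tailsZero_exists_lintegral_exp_gaussMeasure_le hθ hu hθ0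
  have hKi := fun i : Fin (N + 1) =>
    LambertianContactSwapLambertianEulerTailsZero.tailsZero_lintegral_exp_localGibbsLaw_le
      ha hθ hu ha0 hθ0 hK hσ2 N Φ i
  -- the constant of the pointwise bound
  set Cst : ℝ := ((N : ℝ) + 1) ^ p * ((p.factorial : ℝ) * (a ^ p)⁻¹ * Real.exp a) with hCst
  have hCst0 : 0 ≤ Cst := by positivity
  have hpt : ∀ z : Config (N + 1) (Fin 3) T3,
      (1 + ∑ j, ‖(z j).2‖ ^ 2) ^ p ≤ Cst * ∑ j, Real.exp (a * ‖(z j).2‖ ^ 2) := by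
    intro z
    have h1 : 1 + ∑ j, ‖(z j).2‖ ^ 2 ≤ ∑ j : Fin (N + 1), (1 + ‖(z j).2‖ ^ 2) := by
      rw [Finset.sum_add_distrib, Finset.sum_const, Finset.card_univ, Fintype.card_fin, nsmul_eq_mul,
        mul_one]
      have : (1 : ℝ) ≤ (N + 1 : ℕ) := by exact_mod_cast Nat.succ_pos N
      linarith
    calc (1 + ∑ j, ‖(z j).2‖ ^ 2) ^ p
        ≤ (∑ j : Fin (N + 1), (1 + ‖(z j).2‖ ^ 2)) ^ p := pow_le_pow_left₀ (by positivity) h1 p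
      _ ≤ ((N : ℝ) + 1) ^ p * ∑ j : Fin (N + 1), (1 + ‖(z j).2‖ ^ 2) ^ p :=
          pow_sum_le_pow_card_mul_sum_pow _ (fun j => by positivity) p
      _ ≤ ((N : ℝ) + 1) ^ p * ∑ j : Fin (N + 1),
            (p.factorial : ℝ) * (a ^ p)⁻¹ * Real.exp a * Real.exp (a * ‖(z j).2‖ ^ 2) := by
          gcongr with j
          exact one_add_pow_le_exp ha_pos (sq_nonneg _) p
      _ = Cst * ∑ j, Real.exp (a * ‖(z j).2‖ ^ 2) := by
          rw [hCst, ← Finset.mul_sum]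
          ring
  have hmi : ∀ i : Fin (N + 1), Measurable fun z : Config (N + 1) (Fin 3) T3 =>
      ENNReal.ofReal (Real.exp (a * ‖(z i).2‖ ^ 2)) := fun i =>
    (Real.measurable_exp.comp ((measurable_norm.pow_const 2).const_mul a)).ennreal_ofReal.comp
      (measurable_pi_apply i).snd
  calc ∫⁻ z, ENNReal.ofReal ((1 + ∑ j, ‖(z j).2‖ ^ 2) ^ p) ∂(localGibbsLaw σ a₀ u₀ θ₀ N Φ)
      ≤ ∫⁻ z, ENNReal.ofReal Cst * ∑ j, ENNReal.ofReal (Real.exp (a * ‖(z j).2‖ ^ 2))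
          ∂(localGibbsLaw σ a₀ u₀ θ₀ N Φ) := by
        refine lintegral_mono fun z => ?_
        rw [← ENNReal.ofReal_sum_of_nonneg fun j _ => (Real.exp_pos _).le, ← ENNReal.ofReal_mul hCst0]
        exact ENNReal.ofReal_le_ofReal (hpt z)
    _ = ENNReal.ofReal Cst * ∑ j, ∫⁻ z, ENNReal.ofReal (Real.exp (a * ‖(z j).2‖ ^ 2))
          ∂(localGibbsLaw σ a₀ u₀ θ₀ N Φ) := by
        rw [lintegral_const_mul _ (Finset.measurable_sum _ fun i _ => hmi i),
          lintegral_finsetSum _ fun i _ => hmi i]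
    _ ≤ ENNReal.ofReal Cst * ∑ _j : Fin (N + 1), ENNReal.ofReal K := by
        gcongr with j
        exact hKi j
    _ < ∞ := by
        refine ENNReal.mul_lt_top ENNReal.ofReal_lt_top ?_
        rw [Finset.sum_const, Finset.card_univ, Fintype.card_fin, nsmul_eq_mul]
        exact ENNReal.mul_lt_top (ENNReal.natCast_lt_top _) ENNReal.ofReal_lt_top

/-- **Field `finite`**: every moment of the transported local Gibbs law is finite (envelope + Gaussian
integrability). [folklore] -/
theorem velMoment_lt_top (ha : Continuous a₀) (hθ : Continuous θ₀) (hu : Continuous u₀)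
    (ha0 : ∀ x, 0 < a₀ x) (hθ0 : ∀ x, 0 < θ₀ x) {σ : ℝ} (hσ2 : σ ≤ 1 / 2) (N : ℕ)
    (Φ : HardSphereFlow (Torus.geometry (Fin 3)) (hsDiameter σ N) (N + 1)) (p : ℕ) (s : ℝ) :
    velMoment Φ (localGibbsLaw σ a₀ u₀ θ₀ N Φ) p s < ∞ := by
  refine lt_of_le_of_lt ?_ (lintegral_envelope_lt_top ha hθ hu ha0 hθ0 hσ2 N Φ p)
  refine lintegral_mono_ae ?_
  filter_upwards [ae_mem_good_localGibbsLaw σ a₀ u₀ θ₀ N Φ] with z hz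
  exact ENNReal.ofReal_le_ofReal (avg_powSum_flow_le Φ hz p s)

end Gibbs

/-! ## Velocities are locally constant in time off the collision times -/

section LocallyConstant

variable {N : ℕ} {ε : ℝ}

/-- **Off its collision times a good orbit has locally constant velocities.**  If `s₀` is not a collision time
of the orbit of `z ∈ Φ.good`, then for `s` near `s₀` every velocity `vᵢ(Φ_s z)` equals `vᵢ(Φ_{s₀} z)`: the
collision times in `[s₀ − 1, s₀ + 1]` form a finite (closed) set missing `s₀`, so a ball around `s₀` is
collision-free, and on a collision-free stretch the orbit is free flight (`IsHardSphereTrajectory.free`), which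
keeps the velocities (`freeFlight_apply`). [folklore] -/
theorem vel_flow_eventually_eq (Φ : HardSphereFlow (Torus.geometry (Fin 3)) ε (N + 1))
    {z : Config (N + 1) (Fin 3) T3} (hz : z ∈ Φ.good) {s₀ : ℝ}
    (hs₀ : s₀ ∉ collisionTimes (Torus.geometry (Fin 3)) ε fun t => Φ.flow t z) :
    ∀ᶠ s in 𝓝 s₀, ∀ i, (Φ.flow s z i).2 = (Φ.flow s₀ z i).2 := by
  have h := Φ.isTrajectory z hz
  set T : Set ℝ := collisionTimes (Torus.geometry (Fin 3)) ε (fun t => Φ.flow t z) ∩ Icc (s₀ - 1) (s₀ + 1)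
    with hT
  have hfin : T.Finite := h.locFinite _ _
  have hU : Tᶜ ∩ Ioo (s₀ - 1) (s₀ + 1) ∈ 𝓝 s₀ :=
    (hfin.isClosed.isOpen_compl.inter isOpen_Ioo).mem_nhds
      ⟨fun hmem => hs₀ hmem.1, by constructor <;> linarith⟩
  obtain ⟨δ, hδ, hball⟩ := Metric.mem_nhds_iff.1 hU
  have hfree : ∀ τ : ℝ, s₀ - δ < τ → τ < s₀ + δ →
      τ ∉ collisionTimes (Torus.geometry (Fin 3)) ε fun t => Φ.flow t z := by
    intro τ h1 h2 hcol
    have hτ : τ ∈ Metric.ball s₀ δ := by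
      rw [Real.ball_eq_Ioo]
      exact ⟨h1, h2⟩
    exact (hball hτ).1 ⟨hcol, Ioo_subset_Icc_self (hball hτ).2⟩
  rw [Metric.eventually_nhds_iff_ball]
  refine ⟨δ, hδ, fun s hs i => ?_⟩
  rw [Real.ball_eq_Ioo] at hs
  rcases le_total s s₀ with hle | hle
  · -- free flight on `(s, s₀]`
    have hff := h.free s s₀ hle fun τ hτ => hfree τ (by linarith [hτ.1, hs.1]) (by linarith [hτ.2])
    have hi := congrArg Prod.snd (congrFun hff i)
    rw [freeFlight_apply] at hi
    exact hi.symm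
  · -- free flight on `(s₀, s]`
    have hff := h.free s₀ s hle fun τ hτ => hfree τ (by linarith [hτ.1]) (by linarith [hτ.2, hs.2])
    have hi := congrArg Prod.snd (congrFun hff i)
    rw [freeFlight_apply] at hi
    exact hi

end LocallyConstant

/-! ## Continuity in time -/

section Continuity

variable {a₀ θ₀ : T3 → ℝ} {u₀ : T3 → V3}

/-- **A fixed time is almost surely not a collision time.**  For `σ > 0` (so `hsDiameter σ N ≠ 0`) and every
`s₀`, `λ_N`-a.e. orbit has no collision at time `s₀`: the event is contained in
`Φ_{s₀}⁻¹(⋃_{i ≠ j} contactSet i j)`, the contact sets are Lebesgue-null (`volume_contactSet`), hence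
Liouville-null, preimages of Liouville-null sets under `Φ_{s₀}` are Liouville-null
(`HardSphereFlow.liouville_preimage_null`), and `λ_N ≪ Liouville` (`localGibbsLaw_absolutelyContinuous`).
[folklore] -/
theorem ae_not_mem_collisionTimes (σ : ℝ) (hσ : 0 < σ) (a₀ θ₀ : T3 → ℝ) (u₀ : T3 → V3) (N : ℕ)
    (Φ : HardSphereFlow (Torus.geometry (Fin 3)) (hsDiameter σ N) (N + 1)) (s₀ : ℝ) :
    ∀ᵐ z ∂(localGibbsLaw σ a₀ u₀ θ₀ N Φ),
      s₀ ∉ collisionTimes (Torus.geometry (Fin 3)) (hsDiameter σ N) fun t => Φ.flow t z := by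
  have hε : hsDiameter σ N ≠ 0 := (hsDiameter_pos hσ N).ne'
  set S : Set (Config (N + 1) (Fin 3) T3) :=
    ⋃ i : Fin (N + 1), ⋃ j : Fin (N + 1), ⋃ (_ : i ≠ j), contactSet (Torus.geometry (Fin 3)) (N + 1)
      (hsDiameter σ N) i j with hS
  have hS0 : volume S = 0 :=
    measure_iUnion_null fun i => measure_iUnion_null fun j => measure_iUnion_null fun hij =>
      volume_contactSet hε hij
  have hL0 : liouville (Torus.geometry (Fin 3)) (N + 1) (hsDiameter σ N) S = 0 :=
    nonpos_iff_eq_zero.1 ((Measure.restrict_apply_le _ _).trans hS0.le)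
  have hpre := Φ.liouville_preimage_null s₀ hL0
  have hae : ∀ᵐ z ∂(localGibbsLaw σ a₀ u₀ θ₀ N Φ), z ∈ (Φ.flow s₀ ⁻¹' S)ᶜ :=
    (localGibbsLaw_absolutelyContinuous σ a₀ u₀ θ₀ N Φ).ae_le (compl_mem_ae_iff.2 hpre)
  filter_upwards [hae] with z hz hcol
  obtain ⟨i, j, hij, hc⟩ := mem_collisionTimes.1 hcol
  exact hz (mem_preimage.2 (mem_iUnion.2 ⟨i, mem_iUnion.2 ⟨j, mem_iUnion.2 ⟨hij, hc⟩⟩⟩))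

/-- **The moments are continuous in time** (at every `s₀ ∈ ℝ`): dominated convergence with the energy
envelope as the bound and a.e. eventual constancy of the integrand (`vel_flow_eventually_eq` off the null event
`ae_not_mem_collisionTimes`). [folklore] -/
theorem tendsto_velMoment (ha : Continuous a₀) (hθ : Continuous θ₀) (hu : Continuous u₀)
    (ha0 : ∀ x, 0 < a₀ x) (hθ0 : ∀ x, 0 < θ₀ x) {σ : ℝ} (hσ : 0 < σ) (hσ2 : σ ≤ 1 / 2) (N : ℕ)
    (Φ : HardSphereFlow (Torus.geometry (Fin 3)) (hsDiameter σ N) (N + 1)) (p : ℕ) (s₀ : ℝ) :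
    Tendsto (fun s => velMoment Φ (localGibbsLaw σ a₀ u₀ θ₀ N Φ) p s) (𝓝 s₀)
      (𝓝 (velMoment Φ (localGibbsLaw σ a₀ u₀ θ₀ N Φ) p s₀)) := by
  simp only [velMoment]
  refine tendsto_lintegral_filter_of_dominated_convergence
    (fun z => ENNReal.ofReal ((1 + ∑ j, ‖(z j).2‖ ^ 2) ^ p))
    (Eventually.of_forall fun s => measurable_ofReal_avg_powSum Φ p s)
    (Eventually.of_forall fun s => ?_) (lintegral_envelope_lt_top ha hθ hu ha0 hθ0 hσ2 N Φ p).ne ?_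
  · filter_upwards [ae_mem_good_localGibbsLaw σ a₀ u₀ θ₀ N Φ] with z hz
    exact ENNReal.ofReal_le_ofReal (avg_powSum_flow_le Φ hz p s)
  · filter_upwards [ae_mem_good_localGibbsLaw σ a₀ u₀ θ₀ N Φ,
      ae_not_mem_collisionTimes σ hσ a₀ θ₀ u₀ N Φ s₀] with z hz hs₀
    refine tendsto_const_nhds.congr' ?_
    filter_upwards [vel_flow_eventually_eq Φ hz hs₀] with s hs
    simp only [hs]

/-- **Field `continuousOn`** (in fact continuity on all of `ℝ`): `s ↦ (M_p(s)).toReal` is continuous at every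
`s₀` since `M_p(s) → M_p(s₀)` in `ℝ≥0∞` and `M_p(s₀) < ∞`. [folklore] -/
theorem continuousOn_velMoment_toReal (ha : Continuous a₀) (hθ : Continuous θ₀) (hu : Continuous u₀)
    (ha0 : ∀ x, 0 < a₀ x) (hθ0 : ∀ x, 0 < θ₀ x) {σ : ℝ} (hσ : 0 < σ) (hσ2 : σ ≤ 1 / 2) (N : ℕ)
    (Φ : HardSphereFlow (Torus.geometry (Fin 3)) (hsDiameter σ N) (N + 1)) (p : ℕ) :
    ContinuousOn (fun s => (velMoment Φ (localGibbsLaw σ a₀ u₀ θ₀ N Φ) p s).toReal) (Set.Ici 0) := by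
  intro s₀ _
  refine ContinuousAt.continuousWithinAt ?_
  exact (ENNReal.tendsto_toReal (velMoment_lt_top ha hθ hu ha0 hθ0 hσ2 N Φ p s₀).ne).comp
    (tendsto_velMoment ha hθ hu ha0 hθ0 hσ hσ2 N Φ p s₀)

end Continuity

/-! ## The registered helper -/

/-- **Stage 3 of stub R — FINITENESS AND CONTINUITY IN TIME**, registered helper `momentContinuity` of
`stub_momentRegularity` (line `Sketch`, crux stmt-AtomisticToContinuum-17701): for continuous data
`a₀, θ₀ > 0`, `u₀` and `0 < σ ≤ 1/2`, every moment `M_p(s) = velMoment Φ λ_N p s` of the local Gibbs law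
transported by any hard-sphere flow is finite, and `s ↦ M_p(s).toReal` is continuous on `[0, ∞)` (fields
`finite` and `continuousOn` of `MomentRegularityFor σ a₀ u₀ θ₀`). [folklore] -/
theorem momentContinuity :
    ∀ (a₀ θ₀ : T3 → ℝ) (u₀ : T3 → V3), Continuous a₀ → Continuous θ₀ → Continuous u₀ →
      (∀ x, 0 < a₀ x) → (∀ x, 0 < θ₀ x) → ∀ σ : ℝ, 0 < σ → σ ≤ 1 / 2 →
        (∀ (N : ℕ) (Φ : HardSphereFlow (Torus.geometry (Fin 3)) (hsDiameter σ N) (N + 1)) (p : ℕ) (s : ℝ),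
          velMoment Φ (localGibbsLaw σ a₀ u₀ θ₀ N Φ) p s < ∞) ∧
        (∀ (N : ℕ) (Φ : HardSphereFlow (Torus.geometry (Fin 3)) (hsDiameter σ N) (N + 1)) (p : ℕ),
          ContinuousOn (fun s => (velMoment Φ (localGibbsLaw σ a₀ u₀ θ₀ N Φ) p s).toReal) (Set.Ici 0)) := by
  intro a₀ θ₀ u₀ ha hθ hu ha0 hθ0 σ hσ hσ2
  exact ⟨velMoment_lt_top ha hθ hu ha0 hθ0 hσ2, continuousOn_velMoment_toReal ha hθ hu ha0 hθ0 hσ hσ2⟩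

end Summit.AtomisticToContinuum.HydrodynamicLimit.Theorems.SuperExponentialEnergyTailsMomentRegularity

end
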